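import Summits.HodgeConjecture.HodgeConjecture.Theses.HeckePrymWeil
import Summits.HodgeConjecture.HodgeConjecture.Theorems.HeckePrymWeilHodgeWeilOfWeilTransport
import Summits.HodgeConjecture.HodgeConjecture.Theorems.HeckePrymWeilHeckePrymAnchorsOfDeligneWeilFamily
import Literature.AlgebraicGeometry.HodgeTheory.WeilFamilyKAction
import Literature.AlgebraicGeometry.HodgeTheory.WeilFamilyBalanced
import Literature.AlgebraicGeometry.HodgeTheory.BlochSemiregularSpread
import Literature.AlgebraicGeometry.HodgeTheory.AlgebraicityLocus
import Literature.AlgebraicGeometry.HodgeTheory.AlgebraicityLocusIUnionClosedProofs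
import Literature.AlgebraicGeometry.HodgeTheory.AlgebraicClassesHodgeTypeHolds
import Literature.AlgebraicGeometry.HodgeTheory.HypersurfaceLefschetzProofs
import Literature.AlgebraicGeometry.HodgeTheory.MotivatedClassesDeformationInputs
import Literature.AlgebraicGeometry.HodgeTheory.RelativeHyperplaneClassHodgeRiemann
import Literature.AlgebraicGeometry.Motives.VeryGeneralComplexPoint
import Literature.AlgebraicGeometry.Motives.SegreHyperplaneClass
import Literature.AlgebraicGeometry.HodgeTheory.HyperplaneClassRational
import HarnessLib

/-!
# Deligne's Weil family WITH ITS TENSOR ANCHOR, and unconditional Baire propagation of algebraicity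

Route `HeckePrymWeil` (sub-problem `HodgeConjecture`); lead seat c14 of crux `WeilTwelvefoldsSqrtMinus7`
(stmt-HodgeConjecture-1261), line `semiregular-clean-lci-anchor` (crux-strategist, 2026-08-17).  Two pieces
of the line's glue, general in the rung `(p, k)`, landed for its composition
(`HeckePrymWeilHodgeWeilOfSemiregularCleanLci`):

* `forall_mem_algebraicClasses_of_isOpen_nonempty` — UNCONDITIONAL Baire propagation: over a smooth
  irreducible quasi-projective base, a global class algebraic on the fibres over a non-empty Euclidean-open
  set is algebraic on EVERY fibre.  The algebraicity-locus structure theorem it needs is a THEOREM of the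
  tree (`charlesSchnell_algebraicityLocus_iUnion_closed_holds`: hyperplane witness families, embedded log
  resolution, Ehresmann relative to an snc boundary, Mumford's curve lemma), combined with
  `ComplexPoints.exists_mem_forall_pt_not_mem` (very general points are dense).
* `weilFamily_anchorPackage_of_globalAction` — Deligne's family through `X` WITH ITS ANCHOR: besides the
  family, the chart `e : X ≅ 𝒳_{s₁}` and the global Weil class `W` (as in the tree's
  `weilFamily_globalWeilClass_of_globalAction`, lead c5), the tensor fibre `e₀ : Y ≅ 𝒳_{s₀}` with its
  `√-p`-structure `Ψ`, its isogeny pair with `A₁ × A₁`, the global `√-p` endomorphism `g`, and the facts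
  that `x₀ := e₀^*(W|_{s₀})` lies in the strong Weil plane of `(Y, Ψ)` and is NON-ZERO.

CONDITIONAL only on `deligne1982_weilFamily_globalAction` where stated; no `sorry`, no new definition.
-/

noncomputable section

-- every declaration of this problem lives in `Summit.HodgeConjecture.HodgeConjecture.…` (summit = sub-problem)
set_option linter.dupNamespace false

open CategoryTheory AlgebraicGeometry Limits MonoidalCategory CartesianMonoidalCategory
open Literature.AlgebraicGeometry Literature.AlgebraicGeometry.Motives
  Literature.AlgebraicGeometry.HodgeTheory Literature.AlgebraicTopology.SingularHomology

namespace Summit.HodgeConjecture.HodgeConjecture.Theorems.HeckePrymWeilLine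

open Summit.HodgeConjecture.HodgeConjecture.Theses.HeckePrymWeil

/-! ### Baire propagation (unconditional): algebraic on a non-empty open set ⟹ algebraic everywhere -/

/-- **Open-to-everywhere propagation of algebraicity** over a smooth irreducible quasi-projective base:
if the fibre restrictions of a global class `A` are algebraic on a non-empty open subset `U ⊆ S(ℂ)`
(complex topology) then they are algebraic at EVERY complex point.  The algebraicity locus is a countable
union of complex points of Zariski-closed `W_j ⊆ S` (`charlesSchnell_algebraicityLocus_iUnion_closed_holds`,
a theorem of the tree); were some fibre not algebraic, every `W_j` would be proper, and a point of `U`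
outside all of them (Baire: `ComplexPoints.exists_mem_forall_pt_not_mem`) contradicts `U ⊆ ⋃ W_j(ℂ)`.
[cite: VoisinHodgeII2003, §3.3.1] [cite: CharlesSchnell2014Notes, Prop. 11.3.11] -/
theorem forall_mem_algebraicClasses_of_isOpen_nonempty {𝒳 S : SchemeOver ℂ} (f : 𝒳 ⟶ S) {n p : ℕ} (hfam : IsSmoothProjectiveFamily f n)
    (h𝒳 : IsQuasiProjectiveOver 𝒳) (hS : IsQuasiProjectiveOver S) (hsm : AlgebraicGeometry.Smooth S.hom)
    (hirr : IrreducibleSpace S.left) (A : complexBetti 𝒳 (2 * p)) {U : Set (ComplexPoints S)}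
    (hUo : IsOpen U) (hUne : U.Nonempty)
    (hU : ∀ t ∈ U, complexBetti.map (fiberι f t) (2 * p) A ∈ algebraicClasses (fiberOver f t) p) :
    ∀ t : ComplexPoints S, complexBetti.map (fiberι f t) (2 * p) A ∈ algebraicClasses (fiberOver f t) p := by
  obtain ⟨Wj, hWc, hloc⟩ := charlesSchnell_algebraicityLocus_iUnion_closed_holds f n p h𝒳 hS hsm hfam A
  haveI := hirr
  haveI : IsSeparated S.hom := hS.isSeparated
  haveI : LocallyOfFiniteType S.hom := hS.locallyOfFiniteType
  by_contra! hnot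
  obtain ⟨t₀, ht₀⟩ := hnot
  have hne : ∀ j, Wj j ≠ Set.univ := by
    intro j hj
    apply ht₀
    have hmem : t₀ ∈ ⋃ j, {t : ComplexPoints S | t.pt ∈ Wj j} :=
      Set.mem_iUnion.2 ⟨j, by simp [hj]⟩
    rw [← hloc] at hmem
    exact hmem
  obtain ⟨P, hPU, hP⟩ := ComplexPoints.exists_mem_forall_pt_not_mem (X := S) hWc hne hUo hUne
  have hPmem : P ∈ {t : ComplexPoints S |
      complexBetti.map (fiberι f t) (2 * p) A ∈ algebraicClasses (fiberOver f t) p} := hU P hPU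
  rw [hloc] at hPmem
  obtain ⟨j, hj⟩ := Set.mem_iUnion.1 hPmem
  exact hP j hj


/-! ### Deligne's family package WITH ITS ANCHOR -/

/-- **Deligne's Weil family through `X` with its global Weil class AND its tensor anchor exposed.**  The
tree's `weilFamily_globalWeilClass_of_globalAction` (lead c5 of this crux) re-proved with a longer
conclusion: besides the family `f : 𝒳 → S` (smooth projective of relative dimension `2k`, closed in
`ℙᴺ × S`, over a smooth irreducible quasi-projective base), the chart `e : X ≅ 𝒳_{s₁}` and the global class
`W` (fibrewise rational of type `(k,k)`, `W|_{s₁} = e^{-1 *} c`), it returns the TENSOR FIBRE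
`e₀ : Y ≅ 𝒳_{s₀}` with its `√-p`-structure `Ψ`, its isogeny pair with `A₁ × A₁`, and the facts that
`x₀ := e₀^*(W|_{s₀})` lies in the strong Weil plane of `(Y, Ψ)` and is NON-ZERO (parallel transport of
the non-zero `e^{-1 *} c`), together with the global `√-p` endomorphism `g` (over `S`, intertwined with
`Ψ` by `e₀`).  Proof: the section of the package globalised by the W-engine, rationality along the
section, transport of the Weil eigen-lines under the global `√-p` read in the charts, plus
`transportFun_map_fiberι` for the non-vanishing.
[cite: Deligne1982HodgeCycles, proof of Thm. 4.8 (pp. 47–52) with Prop. 4.4, Lemma 4.5, Remark 4.10]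
[cite: VoisinHodgeII2003, §3.1.2] -/
theorem weilFamily_anchorPackage_of_globalAction (hGA : deligne1982_weilFamily_globalAction)
    {p : ℕ} (hp : p.Prime) (hp4 : p % 4 = 3) (hp7 : 7 ≤ p) {k : ℕ} (hk : 1 ≤ k)
    (X : AbelianVariety ℂ) (Φ : X ⟶ X) (hX : X.dim = 2 * k) (hΦ : Φ ≫ Φ = -((p : ℤ) • 𝟙 X))
    (c : complexBetti X.X (2 * k)) (hc : c ∈ weilClassesOf X Φ k p) (hc0 : c ≠ 0)
    (hrat : IsRationalClass c) (hH : IsOfHodgeType (2 * k) X.X (2 * k) k k c) :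
    ∃ (𝒳 S : SchemeOver ℂ) (f : 𝒳 ⟶ S) (s₁ s₀ : ComplexPoints S) (e : X.X ≅ fiberOver f s₁)
      (W : complexBetti 𝒳 (2 * k)) (Y : AbelianVariety ℂ) (Ψ : Y ⟶ Y) (e₀ : Y.X ≅ fiberOver f s₀)
      (g : 𝒳 ⟶ 𝒳),
      IsSmoothProjectiveFamily f (2 * k) ∧
      (∃ (N : ℕ) (ι : 𝒳 ⟶ projectiveSpace N ℂ ⊗ S),
          IsClosedImmersion ι.left ∧ ι ≫ snd (projectiveSpace N ℂ) S = f) ∧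
      IrreducibleSpace S.left ∧ AlgebraicGeometry.Smooth S.hom ∧ IsQuasiProjectiveOver S ∧
      g ≫ f = f ∧ (e₀.hom ≫ fiberι f s₀) ≫ g = Ψ.hom.hom.hom ≫ (e₀.hom ≫ fiberι f s₀) ∧
      (∀ s : ComplexPoints S, IsRationalClass (complexBetti.map (fiberι f s) (2 * k) W) ∧
        IsOfHodgeType (2 * k) (fiberOver f s) (2 * k) k k (complexBetti.map (fiberι f s) (2 * k) W)) ∧
      complexBetti.map (fiberι f s₁) (2 * k) W = complexBetti.map e.inv (2 * k) c ∧
      Y.dim = 2 * k ∧ Ψ ≫ Ψ = -((p : ℤ) • 𝟙 Y) ∧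
      (∃ (A₁ : AbelianVariety ℂ) (f₁ : Y ⟶ A₁.prod A₁) (g₁ : A₁.prod A₁ ⟶ Y) (m : ℕ),
          A₁.dim = k ∧ 0 < m ∧ f₁ ≫ g₁ = m • 𝟙 Y ∧ Flat f₁.hom.hom.hom.left ∧
          g₁ ≫ Ψ = AbelianVariety.prodLift (AbelianVariety.snd A₁ A₁ ≫ (-((p : ℤ) • 𝟙 A₁)))
            (AbelianVariety.fst A₁ A₁) ≫ g₁) ∧
      complexBetti.map e₀.hom (2 * k) (complexBetti.map (fiberι f s₀) (2 * k) W) ∈ weilClassesOf Y Ψ k p ∧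
      complexBetti.map e₀.hom (2 * k) (complexBetti.map (fiberι f s₀) (2 * k) W) ≠ 0 := by
  obtain ⟨𝒳, S, f, g, s₁, s₀, e, σ, hfam, hemb, hirr, hsm, hSqp, hg, hfib, he, hσ, hpt, hσ₁, Y, Ψ,
    e₀, ⟨A₁, f₁, g₁, m, hA₁, hY, hΨ, hm, hfg, hf, hg₁⟩, he₀⟩ := hGA p hp hp4 hp7 k hk X Φ hX hΦ c hc hc0 hrat hH
  have hp0 : 0 < p := hp.pos
  -- the base: `S(ℂ)` is a path-connected manifold and `R^{2k} f_* ℂ` is a local system on it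
  haveI := hsm
  haveI := hirr
  haveI : LocallyOfFiniteType S.hom := hSqp.locallyOfFiniteType
  haveI : ConnectedSpace (ComplexPoints S) :=
    (Motives.ComplexPoints.connectedSpace_iff_holds S).2 inferInstance
  obtain ⟨d, hd⟩ := exists_smoothOfRelativeDimension_of_connectedSpace_complexPoints S
  haveI := hd
  haveI := pathConnectedSpace_complexPoints_of_smoothOfRelativeDimension S d
  have hU := isCohomologicallyLocallyTrivialOn_univ_of_isSmoothProjectiveFamily f d hfam hSqp
  -- the fibre maps of `g`
  have hgf' := fun t ↦ exists_fiberHom_comp_fiberι f g hg t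
  choose gf hgf using hgf'
  -- the cohomological Weil plane of the fibre over `t`
  let WP : ∀ t : ComplexPoints S, Submodule ℂ (complexBetti (fiberOver f t) (2 * k)) :=
    fun t ↦
      Submodule.span ℂ
        {x | ∃ w : Fin (2 * k) → complexBetti (fiberOver f t) 1,
          (∀ i, w i ∈ Module.End.eigenspace (complexBetti.map (gf t) 1).hom
            (Complex.I * (Real.sqrt p : ℂ))) ∧
          cupPowOne ℂ (ComplexPoints (fiberOver f t)) (2 * k) w = x} ⊔
      Submodule.span ℂ
        {x | ∃ w : Fin (2 * k) → complexBetti (fiberOver f t) 1,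
          (∀ i, w i ∈ Module.End.eigenspace (complexBetti.map (gf t) 1).hom
            (-(Complex.I * (Real.sqrt p : ℂ)))) ∧
          cupPowOne ℂ (ComplexPoints (fiberOver f t)) (2 * k) w = x}
  -- at `s₁`: `e^{-1 *} c` lies in the Weil plane of `(𝒳_{s₁}, g_{s₁})`
  have hΦ' : Φ ≫ Φ = -(p • 𝟙 X) := by rw [hΦ, natCast_zsmul]
  have he' : e.hom ≫ gf s₁ = Φ.hom.hom.hom ≫ e.hom :=
    hom_comp_fiberHom_eq_of_comp_fiberι f g (hgf s₁) e Φ.hom.hom.hom he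
  have h₁ : complexBetti.map e.inv (2 * k) c ∈ WP s₁ :=
    map_inv_mem_eigenLines_of_mem_weilClassesOf e (gf s₁) hp0 hX hΦ' he' hc
  -- transport from `s₁`: every value of `σ` lies in the Weil plane of its fibre
  have key : ∀ (s t : ComplexPoints S) (hst : (σ s).pt = t), (σ s).clsAt hst ∈ WP t := by
    intro s t hst
    obtain rfl : s = t := (hpt s).symm.trans hst
    let γ : Path (⟨s₁, Set.mem_univ s₁⟩ : (Set.univ : Set (ComplexPoints S))) ⟨s, Set.mem_univ s⟩ :=
      (PathConnectedSpace.somePath s₁ s).map (continuous_id.subtype_mk _)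
    have htr := transportFun_clsAt_of_continuous f (2 * k) hU hσ hpt γ
    have h0 : (σ s₁).clsAt (hpt s₁) = complexBetti.map e.inv (2 * k) c := by
      rw [FiberClass.clsAt_eq_iff]; exact hσ₁
    change transportFun f (2 * k) hU ⟦γ⟧ ((σ s₁).clsAt (hpt s₁)) = (σ s).clsAt (hpt s) at htr
    rw [← htr, h0]
    exact transportFun_mem_eigenLines f hU g hg gf hgf ⟦γ⟧ _ _ (2 * k) h₁
  -- the global class of the section (W-engine, discharged in the tree)
  obtain ⟨W, hWσ⟩ := stub_globalClassOfSection_of_leray deligne1968_invariantClass_fromTotalSpace_holds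
    f (2 * k) (2 * k) hfam hemb hsm hSqp hirr σ hσ hpt
  have hWs : ∀ s : ComplexPoints S, complexBetti.map (fiberι f s) (2 * k) W = (σ s).clsAt (hpt s) := by
    intro s
    symm
    rw [FiberClass.clsAt_eq_iff]
    exact hWσ s
  -- rationality along the section
  have hrat₁ : IsRationalClass (σ s₁).cls := by
    rw [hσ₁]; exact hrat.map _
  have hratσ : ∀ s, IsRationalClass (σ s).cls :=
    stub_rationalAlongSection f (2 * k) (2 * k) hfam hsm hSqp hirr σ hσ hpt s₁ hrat₁
  -- the charts: `W|_{𝒳_s}` read in `A'_s` lies in the strong Weil plane of `(A'_s, φ'_s)`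
  have hchart : ∀ s : ComplexPoints S, ∃ (A' : AbelianVariety ℂ) (φ' : A' ⟶ A') (e' : A'.X ≅ fiberOver f s),
      A'.dim = 2 * k ∧ φ' ≫ φ' = -((p : ℤ) • 𝟙 A') ∧
      complexBetti.map e'.hom (2 * k) (complexBetti.map (fiberι f s) (2 * k) W) ∈ weilClassesOf A' φ' k p ∧
      ∀ w ∈ weilClassesOf A' φ' k p, IsOfHodgeType (2 * k) A'.X (2 * k) k k w := by
    intro s
    obtain ⟨A', φ', e', hA', hφ', he'c, hbal⟩ := hfib s
    have he'' : e'.hom ≫ gf s = φ'.hom.hom.hom ≫ e'.hom :=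
      hom_comp_fiberHom_eq_of_comp_fiberι f g (hgf _) e' φ'.hom.hom.hom he'c
    refine ⟨A', φ', e', hA', hφ', ?_, hbal⟩
    rw [hWs s]
    exact map_mem_weilClassesOf_of_mem_eigenLines e' (gf _) he'' (key s s (hpt s))
  -- the fibre restrictions of `W` are rational of type `(k,k)`
  have hfibre : ∀ s : ComplexPoints S, IsRationalClass (complexBetti.map (fiberι f s) (2 * k) W) ∧
      IsOfHodgeType (2 * k) (fiberOver f s) (2 * k) k k (complexBetti.map (fiberι f s) (2 * k) W) := by
    intro s
    refine ⟨?_, ?_⟩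
    · rw [hWs s]
      exact (ras_isRationalClass_clsAt_iff (σ s) (hpt s)).2 (hratσ s)
    · obtain ⟨A', φ', e', hA', hφ', hmem, hbal⟩ := hchart s
      have htyp := (hbal _ hmem).map_of_iso e'.symm
      have hid : singularCohomology.map ℂ ℂ (Motives.AlgPoints.mapContinuous (L := ℂ) e'.symm.hom) (2 * k)
          (complexBetti.map e'.hom (2 * k) (complexBetti.map (fiberι f s) (2 * k) W)) =
            complexBetti.map (fiberι f s) (2 * k) W := by
        change complexBetti.map e'.inv (2 * k) (complexBetti.map e'.hom (2 * k) _) = _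
        rw [← ModuleCat.comp_apply, ← complexBetti.map_comp, e'.inv_hom_id, complexBetti.map_id]
        rfl
      rw [hid] at htyp
      exact htyp
  -- at `s₀`: the transported class lies in the strong Weil plane of the tensor fibre `(Y, Ψ)` …
  have he₀' : e₀.hom ≫ gf s₀ = Ψ.hom.hom.hom ≫ e₀.hom :=
    hom_comp_fiberHom_eq_of_comp_fiberι f g (hgf s₀) e₀ Ψ.hom.hom.hom he₀
  have hx : complexBetti.map e₀.hom (2 * k) (complexBetti.map (fiberι f s₀) (2 * k) W) ∈
      weilClassesOf Y Ψ k p := by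
    rw [hWs s₀]
    exact map_mem_weilClassesOf_of_mem_eigenLines e₀ (gf s₀) he₀' (key s₀ s₀ (hpt s₀))
  -- … and is non-zero: `W|_{s₁} = e^{-1 *} c ≠ 0` is the parallel transport of `W|_{s₀}`
  have hW₁ : complexBetti.map (fiberι f s₁) (2 * k) W = complexBetti.map e.inv (2 * k) c := by
    rw [hWs s₁, FiberClass.clsAt_eq_iff]
    exact hσ₁
  have hW₀ne : complexBetti.map (fiberι f s₀) (2 * k) W ≠ 0 := by
    intro h0
    let γ : Path (⟨s₀, Set.mem_univ s₀⟩ : (Set.univ : Set (ComplexPoints S))) ⟨s₁, Set.mem_univ s₁⟩ :=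
      (PathConnectedSpace.somePath s₀ s₁).map (continuous_id.subtype_mk _)
    have htr := transportFun_map_fiberι f (2 * k) hU ⟦γ⟧ W
    change transportFun f (2 * k) hU ⟦γ⟧ (complexBetti.map (fiberι f s₀) (2 * k) W) =
      complexBetti.map (fiberι f s₁) (2 * k) W at htr
    rw [h0] at htr
    have hz : transportFun f (2 * k) hU ⟦γ⟧ (0 : complexBetti (fiberOver f s₀) (2 * k)) = 0 := by
      have := transportFun_smul f (2 * k) hU ⟦γ⟧ (0 : ℂ) (0 : complexBetti (fiberOver f s₀) (2 * k))
      simpa using this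
    rw [hz, hW₁] at htr
    apply hc0
    have : complexBetti.map e.hom (2 * k) (complexBetti.map e.inv (2 * k) c) = c := by
      rw [← CategoryTheory.comp_apply, ← complexBetti.map_comp, Iso.hom_inv_id, complexBetti.map_id,
        CategoryTheory.id_apply]
    rw [← this, ← htr, map_zero]
  have hx0 : complexBetti.map e₀.hom (2 * k) (complexBetti.map (fiberι f s₀) (2 * k) W) ≠ 0 := by
    intro h0
    apply hW₀ne
    have : complexBetti.map e₀.inv (2 * k)
        (complexBetti.map e₀.hom (2 * k) (complexBetti.map (fiberι f s₀) (2 * k) W)) =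
          complexBetti.map (fiberι f s₀) (2 * k) W := by
      rw [← CategoryTheory.comp_apply, ← complexBetti.map_comp, Iso.inv_hom_id, complexBetti.map_id,
        CategoryTheory.id_apply]
    rw [← this, h0, map_zero]
  exact ⟨𝒳, S, f, s₁, s₀, e, W, Y, Ψ, e₀, g, hfam, hemb, hirr, hsm, hSqp, hg, he₀, hfibre, hW₁, hY, hΨ,
    ⟨A₁, f₁, g₁, m, hA₁, hm, hfg, hf, hg₁⟩, hx, hx0⟩


end Summit.HodgeConjecture.HodgeConjecture.Theorems.HeckePrymWeilLine

end
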